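/-
Copyright (c) 2026 the pub-hodgecm-mathlib formalisation cell (harness21).  Prover seat hodgecm-mathlib-K2E2-p12 (g4): Track B «K2-LIT», ENGINE E1,
h413 = stmt-HodgeConjecture-24833; DEAL «R7₂-SCALAR» of K2E1-plan (g4) 2026-09-04T06:35:49Z, FILE 2 (a).
-/
import Summits.HodgeConjecture.HodgeConjecture.Theorems.K2LiuGKRankOneIntegral    -- ★ (K2Liu-p01, O41.5 (1)) `integrable_and_integral_max_one_normAbs_cpow`: `∫_K (max 1 ‖x‖)^{−z} dμ = μ(𝒪)(1 − q^{−z})/(1 − q^{1−z})`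
import Literature.NumberTheory.Automorphic.AdicCompletionResidueCard                  -- ★ `residueFieldCard_adicCompletion_eq : residueFieldCard (v.adicCompletion K) = v.residueCard`
import HarnessLib

/-!
# K2·E1 — `K2E1IntertwiningLocalFactorU2` (a): THE LOCAL FACTOR OF THE `U(J₂)` INTERTWINING CONSTANT at an unramified place — the rank-one integral
# `∫_{K} max(1, ‖t‖_K)^{−2σ} dμ = μ(𝒪_K)·(1 − q^{−2σ})·(1 − q^{−(2σ−1)})⁻¹`, read OFF ★ `K2LiuGKRankOneIntegral`, in E1's two currencies

Track B ∕ K2-LIT, crux h413 = `stmt-HodgeConjecture-24833`, route of record `HCCMUnconditional`; cell `hodgecm-mathlib`, squad K2, ENGINE E1 (campaign «EIS-RANK-ONE», ceiling R7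
at `N = 2`).  DEAL «R7₂-SCALAR» (K2E1-plan (g4)), FILE 2, part (a).  THEOREMS ONLY (no `def`, no instance, no notation, no named-fact hypothesis, no `sorry`; default heartbeats);
lane `--supports stmt-HodgeConjecture-24833 --as helper` (count-neutral).  CENSUS RESULT (this seat, 2026-09-04): the local closed form is ALREADY ★ in the tree, in complex
currency and for every non-archimedean local field — `Summit.….Cruxes.HLiu418.K2LiuGKRankOneIntegral.integrable_and_integral_max_one_normAbs_cpow` (K2Liu-p01 (g2), organ O41.5 of
the K2_Liu road: `∫_K (max 1 ‖x‖_K)^{−z} dμ = μ(𝒪)·(1 − q^{−z})/(1 − q^{1−z})`, `1 < Re z`) — so this file does NOT recompute it: it is the JUNCTION that reads that theorem in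
the two currencies ENGINE E1 uses, token-compatible with FILE 1 ★ `K2E1IntertwiningScalarContinuationU2.hasProd_localScalar` (p857988).

* §1 **`integrable_and_integral_max_one_normAbs_cpow_two_mul`** (generic local field `K`, complex `σ`, `Re σ > ½`): `∫_K (max 1 ‖x‖)^{−2σ} dμ =
  μ(𝒪)·(1 − q^{−2σ})·(1 − q^{−(2σ−1)})⁻¹` — ★ at `z = 2σ` with `1 − 2σ = −(2σ − 1)`: EXACTLY the shape of FILE 1's local Euler factor `(1 − q_v^{−2σ})(1 − q_v^{−(2σ−1)})⁻¹`.
* §2 **`integral_max_one_normAbs_rpow_neg`**, **`integrable_max_one_normAbs_rpow_neg`** (generic `K`, REAL `s > 1` — the currency of ★ `K2E1IntertwiningGrowthU2`, whose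
  `c(σ) = ∫_{N(𝔸)} H(w₀ v)^σ dν` has a REAL exponent): `∫_K max(1, ‖t‖)^{−s} dμ = μ(𝒪)·(1 − q^{−s})/(1 − q^{1−s})` (real powers), by `Complex.ofReal_cpow` + `integral_ofReal` from ★;
  **`integral_max_one_normAbs_rpow_neg_two_mul`** — the same at `s = 2σ`, real `σ > ½`.
* §3 **`integral_max_one_normAbs_cpow_two_mul_adicCompletion`** (a finite place `v` of a number field `F`, `K = F_v`): the same with `q` spelled `v.residueCard` (★
  `residueFieldCard_adicCompletion_eq`) — i.e. `μ(𝒪_v)` times the `v`-TERM of FILE 1's `hasProd_localScalar` BY TOKEN (`(1 - (v.residueCard : ℂ) ^ (-(2 * σ))) * (1 - (v.residueCard : ℂ) ^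
  (-(2 * σ - 1)))⁻¹`); with `μ(𝒪_v) = 1` (self-dual Haar at an unramified place) it IS that term.  FILE 3 (census) multiplies these over `v ∉ S` (adelic Fubini for `N(𝔸) ≅ 𝔸_F`).
Part (b) — `H_v(w₀·u(θt))^σ = max(1, |t|_v)^{−2σ}` place type by place type (inert ∕ ramified `w ∣ v`: `|t|_w = |t|_v²`; split: two `w`, each `|t|_v`) — is the next file.
HONEST LABEL: HC_CM is proved only modulo the 7 printed citations (2 remaining named inputs: hLiu418 = `stmt-HodgeConjecture-24832`, h413 = `stmt-HodgeConjecture-24833`) until rung 0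
closes; this file asserts no named fact and closes no socket; count-neutral.

## References
* [Langlands1976] R. P. Langlands, *On the Functional Equations Satisfied by Eisenstein Series*, LNM 544 (1976): Appendix (rank one, `ξ(2σ−1)/ξ(2σ)`).
* [Casselman1980] W. Casselman, *The unramified principal series of p-adic groups I*, Compositio Math. 40 (1980): §3 Thm. 3.1 (the `c`-function).
* [MoeglinWaldspurger1995] C. Mœglin, J.-L. Waldspurger, *Spectral Decomposition and Eisenstein Series* (1995): II.1.6, IV.1.11.
* [NeukirchANT1999] J. Neukirch, *Algebraic Number Theory* (1999): Ch. II Prop. (4.3) (`q_v = N(v)`).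
-/

set_option autoImplicit false
set_option linter.dupNamespace false -- the mandated namespace repeats `HodgeConjecture.HodgeConjecture`

noncomputable section

open MeasureTheory Filter Topology Set NumberField IsDedekindDomain
open scoped NNReal ENNReal
open Literature.NumberTheory.GaloisRepresentations.IsNonarchimedeanLocalField
open Literature.NumberTheory.Automorphic Literature.NumberTheory.Automorphic.LocalFieldHaar
open Summit.HodgeConjecture.HodgeConjecture.Cruxes.HLiu418.K2LiuGKRankOneIntegral (one_lt_residueFieldCard_real integrable_and_integral_max_one_normAbs_cpow)

namespace Summit.HodgeConjecture.HodgeConjecture.Cruxes.H413.K2E1IntertwiningLocalFactorU2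

section LocalField

variable {F : Type*} [Field F] [ValuativeRel F] [TopologicalSpace F] [IsNonarchimedeanLocalField F]
  [MeasurableSpace F] [BorelSpace F] (μ : Measure F) [μ.IsAddHaarMeasure]

/-! ## §1 Complex currency at `z = 2σ`: the shape of FILE 1's local Euler factor -/

/-- **THE `U(J₂)` LOCAL SCALAR, complex `σ` with `Re σ > ½`**: `∫_K (max 1 ‖x‖_K)^{−2σ} dμ(x) = μ(𝒪_K)·(1 − q^{−2σ})·(1 − q^{−(2σ−1)})⁻¹`, and the integrand is integrable —
★ `K2LiuGKRankOneIntegral.integrable_and_integral_max_one_normAbs_cpow` at `z = 2σ` (`Re z = 2 Re σ > 1`), with `1 − 2σ = −(2σ − 1)`.  The right-hand factor is the `v`-term of ★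
`K2E1IntertwiningScalarContinuationU2.hasProd_localScalar` (`ζ^S(2σ−1)/ζ^S(2σ)`). [cite: Casselman1980, §3 Thm. 3.1] [cite: Langlands1976, Appendix] -/
theorem integrable_and_integral_max_one_normAbs_cpow_two_mul {σ : ℂ} (hσ : 1 / 2 < σ.re) :
    Integrable (fun x : F => (((max 1 ((normAbs F x : ℝ≥0) : ℝ) : ℝ) : ℂ) ^ (-(2 * σ)))) μ ∧
    ∫ x, (((max 1 ((normAbs F x : ℝ≥0) : ℝ) : ℝ) : ℂ) ^ (-(2 * σ))) ∂μ =
      μ.real (primePowBall F 0) *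
        ((1 - (residueFieldCard F : ℂ) ^ (-(2 * σ))) * (1 - (residueFieldCard F : ℂ) ^ (-(2 * σ - 1)))⁻¹) := by
  have h2 : (2 * σ).re = 2 * σ.re := by simp [Complex.mul_re]
  have hz : 1 < (2 * σ).re := by rw [h2]; linarith
  obtain ⟨hi, h⟩ := integrable_and_integral_max_one_normAbs_cpow μ hz
  refine ⟨hi, ?_⟩
  rw [h, show (1 : ℂ) - 2 * σ = -(2 * σ - 1) by ring, div_eq_mul_inv]

/-! ## §2 Real currency (`s > 1` real): the exponent of ENGINE E1's `c(σ) = ∫ H(w₀ v)^σ dν` is real -/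

omit [MeasurableSpace F] [BorelSpace F] in
/-- Pointwise: the complex integrand at a real exponent is the real integrand cast to `ℂ` (`Complex.ofReal_cpow`, base `≥ 1 ≥ 0`). [folklore] -/
theorem integrand_ofReal (x : F) (s : ℝ) :
    (((max 1 ((normAbs F x : ℝ≥0) : ℝ) : ℝ) : ℂ) ^ (-((s : ℝ) : ℂ))) = (((max 1 ((normAbs F x : ℝ≥0) : ℝ)) ^ (-s) : ℝ) : ℂ) := by
  rw [show (-((s : ℝ) : ℂ)) = ((-s : ℝ) : ℂ) by push_cast; ring, ← Complex.ofReal_cpow (le_trans zero_le_one (le_max_left _ _))]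

/-- **`t ↦ max(1, ‖t‖_K)^{−s}` (real power) is integrable for real `s > 1`** (real part of the ★ complex statement at `z = s`). [cite: Casselman1980, §3 Thm. 3.1] -/
theorem integrable_max_one_normAbs_rpow_neg {s : ℝ} (hs : 1 < s) :
    Integrable (fun t : F => (max 1 ((normAbs F t : ℝ≥0) : ℝ)) ^ (-s)) μ := by
  have hz : 1 < ((s : ℝ) : ℂ).re := by rwa [Complex.ofReal_re]
  have h := (integrable_and_integral_max_one_normAbs_cpow μ hz).1
  have hfun : (fun x : F => (((max 1 ((normAbs F x : ℝ≥0) : ℝ) : ℝ) : ℂ) ^ (-((s : ℝ) : ℂ)))) =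
      fun x : F => (((max 1 ((normAbs F x : ℝ≥0) : ℝ)) ^ (-s) : ℝ) : ℂ) := funext fun x => integrand_ofReal x s
  rw [hfun] at h
  exact h.re.congr (Filter.Eventually.of_forall fun x => by simp)

/-- **THE LOCAL FACTOR IN REAL CURRENCY**: for real `s > 1`, `∫_K max(1, ‖t‖_K)^{−s} dμ(t) = μ(𝒪_K)·(1 − q^{−s})/(1 − q^{1−s})` (real powers of the real number `q`) — the ★ complex
identity at `z = s` read through `Complex.ofReal_cpow` and `integral_ofReal`.  `= μ(𝒪)·ζ_K(s−1)/ζ_K(s)`. [cite: Casselman1980, §3 Thm. 3.1] [cite: Langlands1976, Appendix] -/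
theorem integral_max_one_normAbs_rpow_neg {s : ℝ} (hs : 1 < s) :
    ∫ t, (max 1 ((normAbs F t : ℝ≥0) : ℝ)) ^ (-s) ∂μ =
      μ.real (primePowBall F 0) * ((1 - (residueFieldCard F : ℝ) ^ (-s)) / (1 - (residueFieldCard F : ℝ) ^ (1 - s))) := by
  have hz : 1 < ((s : ℝ) : ℂ).re := by rwa [Complex.ofReal_re]
  have h := (integrable_and_integral_max_one_normAbs_cpow μ hz).2
  have hfun : (fun x : F => (((max 1 ((normAbs F x : ℝ≥0) : ℝ) : ℝ) : ℂ) ^ (-((s : ℝ) : ℂ)))) =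
      fun x : F => (((max 1 ((normAbs F x : ℝ≥0) : ℝ)) ^ (-s) : ℝ) : ℂ) := funext fun x => integrand_ofReal x s
  rw [hfun, integral_complex_ofReal] at h
  have hq0 : (0 : ℝ) ≤ (residueFieldCard F : ℝ) := Nat.cast_nonneg _
  have hrhs : (μ.real (primePowBall F 0) : ℂ) *
      ((1 - (residueFieldCard F : ℂ) ^ (-((s : ℝ) : ℂ))) / (1 - (residueFieldCard F : ℂ) ^ (1 - ((s : ℝ) : ℂ)))) =
      ((μ.real (primePowBall F 0) * ((1 - (residueFieldCard F : ℝ) ^ (-s)) / (1 - (residueFieldCard F : ℝ) ^ (1 - s))) : ℝ) : ℂ) := by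
    rw [show (-((s : ℝ) : ℂ)) = ((-s : ℝ) : ℂ) by push_cast; ring, show (1 - ((s : ℝ) : ℂ)) = ((1 - s : ℝ) : ℂ) by push_cast; ring,
      show (residueFieldCard F : ℂ) = ((residueFieldCard F : ℝ) : ℂ) by push_cast; rfl, ← Complex.ofReal_cpow hq0, ← Complex.ofReal_cpow hq0]
    push_cast
    ring
  rw [hrhs] at h
  exact_mod_cast h

/-- **The `U(J₂)` reading in real currency** (`s = 2σ`, real `σ > ½`): `∫_K max(1, ‖t‖_K)^{−2σ} dμ = μ(𝒪_K)·(1 − q^{−2σ})·(1 − q^{−(2σ−1)})⁻¹`.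
[cite: Langlands1976, Appendix] [cite: MoeglinWaldspurger1995, II.1.6] -/
theorem integral_max_one_normAbs_rpow_neg_two_mul {σ : ℝ} (hσ : 1 / 2 < σ) :
    ∫ t, (max 1 ((normAbs F t : ℝ≥0) : ℝ)) ^ (-(2 * σ)) ∂μ =
      μ.real (primePowBall F 0) * ((1 - (residueFieldCard F : ℝ) ^ (-(2 * σ))) * (1 - (residueFieldCard F : ℝ) ^ (-(2 * σ - 1)))⁻¹) := by
  rw [integral_max_one_normAbs_rpow_neg μ (by linarith), show (1 : ℝ) - 2 * σ = -(2 * σ - 1) by ring, div_eq_mul_inv]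

end LocalField

/-! ## §3 At a finite place `v` of a number field: `q` spelled `v.residueCard` — the `v`-term of FILE 1's Euler product by token -/

section Place

variable {K : Type} [Field K] [NumberField K] (v : HeightOneSpectrum (𝓞 K))
  [MeasurableSpace (v.adicCompletion K)] [BorelSpace (v.adicCompletion K)] (μ : Measure (v.adicCompletion K)) [μ.IsAddHaarMeasure]

/-- **THE LOCAL FACTOR AT `v`, IN FILE 1's TOKENS**: for complex `σ` with `Re σ > ½`,
`∫_{K_v} (max 1 ‖x‖_v)^{−2σ} dμ = μ(𝒪_v) · [(1 − N(v)^{−2σ})·(1 − N(v)^{−(2σ−1)})⁻¹]`, `N(v) = v.residueCard = q_v` (★ `residueFieldCard_adicCompletion_eq`); the bracket is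
LITERALLY the `v`-term of ★ `K2E1IntertwiningScalarContinuationU2.hasProd_localScalar` (whose product over `v ∉ S` is `ζ_K^S(2σ−1)/ζ_K^S(2σ)`), so with the self-dual
normalisation `μ(𝒪_v) = 1` at an unramified `v` the local intertwining scalar IS that Euler factor. [cite: NeukirchANT1999, Ch. II Prop. (4.3)] [cite: Casselman1980, §3 Thm. 3.1] -/
theorem integral_max_one_normAbs_cpow_two_mul_adicCompletion {σ : ℂ} (hσ : 1 / 2 < σ.re) :
    ∫ x, (((max 1 ((normAbs (v.adicCompletion K) x : ℝ≥0) : ℝ) : ℝ) : ℂ) ^ (-(2 * σ))) ∂μ =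
      μ.real (primePowBall (v.adicCompletion K) 0) *
        ((1 - (v.residueCard : ℂ) ^ (-(2 * σ))) * (1 - (v.residueCard : ℂ) ^ (-(2 * σ - 1)))⁻¹) := by
  rw [(integrable_and_integral_max_one_normAbs_cpow_two_mul μ hσ).2, residueFieldCard_adicCompletion_eq]

/-- **Unramified normalisation**: if `μ(𝒪_v) = 1` then the local scalar at `v` equals FILE 1's Euler factor at `v` on the nose. [cite: Casselman1980, §3 Thm. 3.1] -/
theorem integral_max_one_normAbs_cpow_two_mul_adicCompletion_of_measureReal_eq_one
    (hμ : μ.real (primePowBall (v.adicCompletion K) 0) = 1) {σ : ℂ} (hσ : 1 / 2 < σ.re) :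
    ∫ x, (((max 1 ((normAbs (v.adicCompletion K) x : ℝ≥0) : ℝ) : ℝ) : ℂ) ^ (-(2 * σ))) ∂μ =
      (1 - (v.residueCard : ℂ) ^ (-(2 * σ))) * (1 - (v.residueCard : ℂ) ^ (-(2 * σ - 1)))⁻¹ := by
  rw [integral_max_one_normAbs_cpow_two_mul_adicCompletion v μ hσ, hμ, Complex.ofReal_one, one_mul]

end Place

end Summit.HodgeConjecture.HodgeConjecture.Cruxes.H413.K2E1IntertwiningLocalFactorU2

end
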